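import Literature.NumberTheory.FaltingsSerre.Paramodular587minus
import Literature.NumberTheory.FaltingsSerre.CriterionProofs
import HarnessLib

/-!
# `A⁻₅₈₇` is paramodular of level `587` away from `587` — criterion discharged (re-certification of [BPPTVY, Thm 7.3.1])

[BPPTVY] = A. Brumer, A. Pacetti, C. Poor, G. Tornaría, J. Voight, D. S. Yuen, *On the paramodularity of
typical abelian surfaces*, Algebra & Number Theory **13**:5 (2019) 1145–1195 [cite: BrumerEtAl2019]:
§7.3, Thm 7.3.1 p. 1191 — the MINUS pair `(Jac(C⁻), f₅₈₇⁻)`, `C⁻ : y² + (x³+x+1)y = −x²−x` (LMFDB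
`587.a.587.1`; `4P+Q² = x⁶+2x⁴+2x³−3x²−2x+1` is, identically, the PRINTED row "587b … S6" of
[BK14, Table 2 p. 2512] = Brumer–Kramer, Trans. Amer. Math. Soc. **366** (2014)
[cite: BrumerKramer2014] — the other printed class of conductor 587, row "587a … S6, mild@3", is the
cell's `A⁺₅₈₇`), image `S₆`, `|P(587)| = 11`, printed `Q₃(f₅₈₇⁻,T) = 1+4T+9T²+12T³+9T⁴` and
`Q₁₁ = 1+T−T²+11T³+121T⁴` (proof of Thm 7.3.1, p. 1191).  [PY15] = C. Poor, D. S. Yuen, *Paramodular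
cusp forms*, Math. Comp. **84** (2015) 1401–1438 [cite: PoorYuen2015]: Thm 1.2 (p. 1402) and Table 5
(p. 1433: column `587⁻`, `λ₂ = −3`, `λ₃ = −4`, `λ₄ = 3`, `λ₅ = −2`, `λ₇ = 0`, `λ₉ = 6`, `λ₁₁ = −1`);
[GPY20] = V. Gritsenko, C. Poor, D. S. Yuen, *Antisymmetric paramodular forms of weights 2 and 3*,
IMRN 2020 [cite: GritsenkoPoorYuen2020] — `f₅₈₇⁻` as a Borcherds product ([BPPTVY, (6.2.8)–(6.2.10)
p. 1180]: `f⁻₅₈₇ = Borch(ψ)`, `dim S₂(K(587))⁻ = 1`, `Q₂, Q₃` of type (G)); [PSY20] = C. Poor,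
J. Shurman, D. S. Yuen, J. Korean Math. Soc. **57** (2020), no. 2, 507–522 [cite: PoorShurmanYuen2020]:
Thm 1.1 (p. 508: `dim S₂(K(587))⁻ = 1`, `dim S₂(K(587))⁺ = 19 = 18 + 1`) and Thm 1.2 (p. 509, proof
§6 pp. 520–521: the website formulas `f_N = Q_N/L_N` of [PY15] are correct for
`N = 349, 353, 389, 461, 523, 587±` — the formula of the website file `QL-587minus.txt`).

`Literature.NumberTheory.FaltingsSerre.Paramodular587minus.paramodular_587minus` (p215182, commit
`b18198c0cd86`; instance of `ParamodularTemplate.lean` for the frozen certificate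
`certs/587/minus/certificate.canonical.json`, sha256
`3ecc7fdaad431fe1aa2cebdb3d9fd053bdbf5c23e813cbf52062eb7b084bc5cd`) carries the hypothesis
`hFS : traceEq_of_faltingsSerre_symplectic` (the Faltings–Serre criterion [BPPTVY, Thm. 2.1.5 p. 1150 /
Alg. 2.4.1 p. 1155] as a named statement).  That statement is PROVED in the tree
(`Literature.NumberTheory.FaltingsSerre.traceEq_of_faltingsSerre_symplectic_holds`,
`CriterionProofs.lean`, p181742), so — exactly as the `_holds` files for `N = 277, 349, 353` and `587⁺`
(and the companion `N = 461` file) do — this file restates `paramodular_587minus` WITHOUT `hFS`.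
Remaining binders: the certificate `hC` (discharged outside the kernel, every load-bearing datum by two
independent implementations: Galois half = engineer-1 gen 3 `certs/587/galois`, cited in the certificate
by hash `5ba9346a…` (image `S₆`, `K₀` of degree 20, `Cl_S(K₀) = 1` GRH-free twice, reproduces BPPTVY's
printed `P(587) = {3,5,7,11,13,17,19,23,29,37,41}` exactly); form half = `λ_p(f₅₈₇⁻)` ×4 (E2d, E2f
Fourier–Jacobi expansions of the Borcherds product; E2g, E2h restriction engines) at `p ≤ 11` and ×3
(E2d, E2f, E2g) at `13 ≤ p ≤ 43` — `−4,−2,0,−1,−2,0,−7,−5,5,−4,1` on `P(587)` = `a_p(A⁻)` from five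
curve seats —, `Q₃/Q₅/Q₇` ×2, `Q₁₁` ×2 (`b₁₁ = −1` by the code-disjoint restriction engines E2g + E2h,
ruling S56); residual Step 1 of record = Route E (ruling S52 (1): étale-algebra sieve on the `λ_p`
parities, sole survivor `6.2.37568.1 = E(ρ̄_A)`, two implementations + referee third path), cross-checked
by the printed route (`Q₃, Q₁₁ mod 2` at `{3, 11}`, every coefficient ×2 on both sides); REFEREE.md
rulings S32/S52/S56; the freeze audit A1–A10 of `certs/587/minus` (producer merge
`code/cert_tools/merge_587minus.py`, 12/12 hard checks, GRH-free) is requested and pending at the time of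
writing), the `A`-side frame/Euler data, the cited `ρ_{f,2}` of [BPPTVY, Thm. 4.3.4 p. 1169] (`hρf`,
Arthur-dependent via Mok, bib `Mok2014Compositio`), the form data, and the Euler factor at `p = 2`
PINNED on both sides (binders `h2A`, `h2f`: `a₂ = −3`, `b₂ = 5`; `L₂ = Q₂ = 1 + 3T + 5T² + 6T³ + 4T⁴`
= [BPPTVY, (6.2.10) p. 1180]; [PY15] Table 5 `λ₂ = −3`, `λ₄ = 3`).
HONEST FRAMING: a re-certification of a published theorem ([BPPTVY, Thm 7.3.1]); the value is the
two-implementation certificate and the kernel-checked assembly, not the theorem — never 'new'.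
-/

noncomputable section

namespace Literature.NumberTheory.FaltingsSerre.Paramodular587minus

open Polynomial IsDedekindDomain
open Literature.NumberTheory.FaltingsSerre Literature.NumberTheory.GaloisRepresentations
  Literature.NumberTheory.Automorphic.Paramodular Literature.NumberTheory.Automorphic
  Literature.AlgebraicGeometry.Motives
open scoped NumberField

/-- **`A⁻ = Jac(C⁻)`, `C⁻ = 587.a.587.1`, is paramodular of level `587` away from `587`, with partner
`f₅₈₇⁻` — criterion discharged**: the statement of `paramodular_587minus` without `hFS`, supplied by
`traceEq_of_faltingsSerre_symplectic_holds` ([BPPTVY, Thm. 2.1.5 p. 1150 / Alg. 2.4.1 p. 1155], proved in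
`CriterionProofs.lean`).  A re-certification of the printed [BPPTVY, Thm. 7.3.1 p. 1191]. [cite: BrumerEtAl2019, Thm 7.3.1 p. 1191; Thm 2.1.5 p. 1150; Alg 2.4.1 p. 1155; Thm 4.3.4 p. 1169; PoorYuen2015, Table 5 p. 1433; GritsenkoPoorYuen2020] -/
theorem paramodular_587minus_holds
    {A : AbelianVariety ℚ} {f : Matrix (Fin 2) (Fin 2) ℂ → ℂ}
    {ρA ρf : FramedGaloisRep ℚ ℤ_[2] 4} {J : Matrix (Fin 4) (Fin 4) ℤ_[2]}
    {ν : Field.absoluteGaloisGroup ℚ → ℤ_[2]}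
    {b : Module.Basis (Fin 4) ℚ_[2] (A.rationalTateModule 2)}
    (hC : Certificate587minus J ν ρA ρf)
    (hframe : A.IsFrameOfTateRep 2 b (rationalize ρA))
    (aA bA af bf : ℕ → ℤ)
    (hA : ∀ p : ℕ, p.Prime → ¬ p ∣ 587 →
      A.HasGoodEulerFactorAt p ((lPolynomialOfSurface p (aA p) (bA p)).map (Int.castRingHom ℚ)))
    (hρf : ∀ p : ℕ, p.Prime → ¬ p ∣ 587 → p ≠ 2 →
      ∀ v : HeightOneSpectrum (𝓞 ℚ), ((p : ℕ) : 𝓞 ℚ) ∈ v.asIdeal →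
        ρf.HasFrobCharpolyAt v
          ((lPolynomialOfSurface p (af p) (bf p)).reverse.map (Int.castRingHom ℤ_[2])))
    (hcusp : IsParamodularCuspForm 587 2 f) (hne : ∃ Z ∈ siegelUpperHalfSpace 2, f Z ≠ 0)
    (hfe : ∀ p : ℕ, p.Prime → ¬ p ∣ 587 →
      HasSpinorEulerFactorAt 2 p f ((lPolynomialOfSurface p (af p) (bf p)).map (Int.castRingHom ℂ)))
    (h2A : aA 2 = -3 ∧ bA 2 = 5) (h2f : af 2 = -3 ∧ bf 2 = 5) :
    IsParamodularAwayFrom A 587 f :=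
  paramodular_587minus traceEq_of_faltingsSerre_symplectic_holds hC hframe aA bA af bf hA hρf hcusp hne
    hfe h2A h2f

/-- The unconditional conclusion at one prime `p ≠ 587`: one polynomial is both `L_p(A⁻,T)` and
`Q_p(f₅₈₇⁻,T)` (via the level-`587`, sign-free lemma `Paramodular587plus.eulerFactors_agree_587plus`;
the landed instance file deliberately carries no `eulerFactors_agree_587minus` duplicate). [cite: BrumerEtAl2019, Thm 7.3.1 p. 1191] -/
theorem eulerFactors_agree_587minus_holds
    {A : AbelianVariety ℚ} {f : Matrix (Fin 2) (Fin 2) ℂ → ℂ}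
    {ρA ρf : FramedGaloisRep ℚ ℤ_[2] 4} {J : Matrix (Fin 4) (Fin 4) ℤ_[2]}
    {ν : Field.absoluteGaloisGroup ℚ → ℤ_[2]}
    {b : Module.Basis (Fin 4) ℚ_[2] (A.rationalTateModule 2)}
    (hC : Certificate587minus J ν ρA ρf)
    (hframe : A.IsFrameOfTateRep 2 b (rationalize ρA))
    (aA bA af bf : ℕ → ℤ)
    (hA : ∀ p : ℕ, p.Prime → ¬ p ∣ 587 →
      A.HasGoodEulerFactorAt p ((lPolynomialOfSurface p (aA p) (bA p)).map (Int.castRingHom ℚ)))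
    (hρf : ∀ p : ℕ, p.Prime → ¬ p ∣ 587 → p ≠ 2 →
      ∀ v : HeightOneSpectrum (𝓞 ℚ), ((p : ℕ) : 𝓞 ℚ) ∈ v.asIdeal →
        ρf.HasFrobCharpolyAt v
          ((lPolynomialOfSurface p (af p) (bf p)).reverse.map (Int.castRingHom ℤ_[2])))
    (hcusp : IsParamodularCuspForm 587 2 f) (hne : ∃ Z ∈ siegelUpperHalfSpace 2, f Z ≠ 0)
    (hfe : ∀ p : ℕ, p.Prime → ¬ p ∣ 587 →
      HasSpinorEulerFactorAt 2 p f ((lPolynomialOfSurface p (af p) (bf p)).map (Int.castRingHom ℂ)))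
    (h2A : aA 2 = -3 ∧ bA 2 = 5) (h2f : af 2 = -3 ∧ bf 2 = 5) {p : ℕ} (hp : p.Prime)
    (hpN : p ≠ 587) :
    ∃ Q : Polynomial ℚ, HasSpinorEulerFactorAt 2 p f (Q.map (algebraMap ℚ ℂ)) ∧
      A.HasGoodEulerFactorAt p Q :=
  Paramodular587plus.eulerFactors_agree_587plus
    (paramodular_587minus_holds hC hframe aA bA af bf hA hρf hcusp hne hfe h2A h2f) hp hpN

end Literature.NumberTheory.FaltingsSerre.Paramodular587minus

end
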